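import Summits.QuantumFields.YangMills.Theorems.AllWindowsColdBoxBoxHighLineEdgeChartGaussianMoments
import Summits.QuantumFields.YangMills.Theorems.AllWindowsColdBoxBoxHighLineHodgePoincareStub
import Summits.QuantumFields.YangMills.Theorems.AllWindowsColdBoxBoxHighLineStep2Wick

/-!
# T-S5.12b «QuadFormFluct» — Gaussian variance of a quadratic form of the edge field: `Var₀(a·Ma) ≤ C·(H⁴/β²)·Σ M_{ij}²`

Brick T-S5.12b of planner ym-idea-2 g18's WICK LAYER (✓`…Theorems.AllWindowsColdBoxBoxHighLineStep2Wick`, w3 g40's copy of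
`Cruxes/BoxHighWindowsSU22/TaskS5Step2Wick.lean`) for STEP 2 of the XL stub S5 `stub_landauSecondOrder` (LINE-19, ⟨stmt-QuantumFields-24004⟩/⟨24335⟩):
BY NAME `quadFormFluct : QuadFormFluct` with `C = 1/(2c₁²)`, `c₁` the Hodge–Poincaré constant of ✓S1 `stub_hodgePoincare`.
Route (Wick's three pairings of four legs, no other diagrams):
* §1 matrix algebra (any finite index type): `S₀ = RᵀR` for positive-definite `S₀` (`CFC.sqrt`); the two «two-line» traces
  `Σ_{ik} S₀_{ik}(MS₀Mᵀ)_{ik} = ‖RMRᵀ‖_F²`, `Σ_{ik} (S₀Mᵀ)_{ik}(MS₀)_{ik} = tr((RMRᵀ)²) ≤ ‖RMRᵀ‖_F²`; `‖RMRᵀ‖_F² ≤ λ²‖M‖_F²` under `y⬝S₀y ≤ λ‖y‖²`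
  (`twoLine_le`); the inverse floor `μ‖y‖² ≤ y⬝Py ⇒ x⬝P⁻¹x ≤ μ⁻¹‖x‖²` (`inv_quadForm_le_of_floor`);
* §2 the Gaussian `exp(−β vᵀPv) dv` in the letters of ✓`GaussianChartWickFintype` (`Z = √(π/β)^{|ι|}/√det P`): `v⬝Mv = Σ_i (e_i⬝v)(M_i⬝v)`, first and
  second moments by ✓`integral_dotProduct_mul_dotProduct_mul_exp_quadForm'` / ✓`integral_four_dotProduct_mul_exp_quadForm'` (integrability
  ✓`integrable_prod_dotProduct_mul_exp_quadForm'`), hence ★`variance_quadForm_le`: `E₀[(v⬝Mv)²] − E₀[v⬝Mv]² ≤ (2β²μ²)⁻¹·Σ M_{ij}²` for any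
  floor `μ‖y‖² ≤ y⬝Py` (`Var = (2β)⁻²[tr(S₀MS₀Mᵀ) + tr(MS₀MS₀)]`, `S₀ = P⁻¹ ≤ μ⁻¹`);
* §3 the task letters: `flat = flatten` (✓fcl-p3), `boxQuadForm H a = ♭a⬝(hodgeQ H ⊗ₖ 1₃)♭a` (✓`EdgeChartGaussian.colourForm_eq_flat`), transfer
  ✓`EdgeChartGaussian.integral_eq_flat`, Kronecker floor `c₁/H²` from ✓S1 via ✓`SpectralFloor.floor_blockDiagonal_const`,
  ✓`GaussianChartWick.posDef_kronecker_one` + ✓`hodgeQ_posDef`; `μ = c₁/H²` gives `(2β²μ²)⁻¹ = (1/(2c₁²))·H⁴/β²`.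
Tree + Mathlib only; no definitions.  HONEST LABEL: one S/M brick of STEP 2 of the XL stub S5 of a critic-PASSed DRAFT line; S5, U5,
⟨stmt-QuantumFields-24004⟩ ⟨24335⟩ ⟨24336⟩ remain OPEN; route AllWindowsColdBox is DRAFT; no rung is proved; **the Yang–Mills mass gap is NOT
proved by this file; no summit is proved by a line.**  Seat ym-line-sfw-p2-w5 g22 (EXTRA WIDTH seat w5, cell ym-idea-1).
-/

set_option autoImplicit false

noncomputable section

open MeasureTheory Matrix Finset
open scoped Kronecker MatrixOrder

namespace Summit.QuantumFields.YangMills.Theorems.AllWindowsColdBoxBoxHighLine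

namespace QuadFluct

/-! ## §1 Matrix algebra: the two «two-line» traces of a quadratic form against a covariance `S₀ = RᵀR` -/

section MatrixAlgebra

variable {ι : Type*} [Fintype ι]

/-- A real positive-definite matrix is `RᵀR` for some real square `R` (`R = √S` from the continuous functional calculus; any finite index type). -/
theorem exists_transpose_mul_self [DecidableEq ι] (S : Matrix ι ι ℝ) (hS : S.PosDef) : ∃ R : Matrix ι ι ℝ, Rᵀ * R = S := by
  have h0 : 0 ≤ S := hS.posSemidef.nonneg
  set R : Matrix ι ι ℝ := CFC.sqrt S with hR
  have hRR : R * R = S := CFC.sqrt_mul_sqrt_self S h0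
  have hRpsd : R.PosSemidef := (CFC.sqrt_nonneg S).posSemidef
  have hRt : Rᵀ = R := by
    have h := hRpsd.isHermitian
    rwa [Matrix.IsHermitian, Matrix.conjTranspose_eq_transpose_of_trivial] at h
  exact ⟨R, by rw [hRt, hRR]⟩

/-- `‖R y‖² = y ⬝ (RᵀR) y`. -/
theorem mulVec_dotProduct_mulVec (R : Matrix ι ι ℝ) (y : ι → ℝ) :
    R *ᵥ y ⬝ᵥ R *ᵥ y = y ⬝ᵥ ((Rᵀ * R) *ᵥ y) := by
  conv_rhs => rw [← Matrix.mulVec_mulVec, Matrix.dotProduct_mulVec, Matrix.vecMul_transpose]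

/-- The Frobenius norm `Σ_{mn} (R Y)_{mn}²` is the sum over the columns `y_n` of `‖R y_n‖²`. -/
theorem sum_sq_mul_eq_sum_cols (R Y : Matrix ι ι ℝ) :
    ∑ m, ∑ n, (R * Y) m n ^ 2 = ∑ n, (R *ᵥ fun i => Y i n) ⬝ᵥ (R *ᵥ fun i => Y i n) := by
  rw [Finset.sum_comm]
  refine Finset.sum_congr rfl fun n _ => ?_
  simp only [dotProduct, pow_two]
  rfl

/-- **Frobenius contraction**: if `y ⬝ (RᵀR) y ≤ λ‖y‖²` for all `y`, then `‖R Y‖_F² ≤ λ‖Y‖_F²`. -/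
theorem sum_sq_mul_le (R Y : Matrix ι ι ℝ) {lam : ℝ} (hlam : ∀ y : ι → ℝ, y ⬝ᵥ ((Rᵀ * R) *ᵥ y) ≤ lam * (y ⬝ᵥ y)) :
    ∑ m, ∑ n, (R * Y) m n ^ 2 ≤ lam * ∑ i, ∑ n, Y i n ^ 2 := by
  rw [sum_sq_mul_eq_sum_cols, Finset.sum_comm (f := fun i n => Y i n ^ 2), Finset.mul_sum]
  refine Finset.sum_le_sum fun n _ => ?_
  rw [mulVec_dotProduct_mulVec]
  refine (hlam _).trans (le_of_eq ?_)
  simp only [dotProduct, pow_two]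

/-- `‖Y Rᵀ‖_F² = ‖R Yᵀ‖_F²`. -/
theorem sum_sq_mul_transpose (R Y : Matrix ι ι ℝ) :
    ∑ m, ∑ n, (Y * Rᵀ) m n ^ 2 = ∑ m, ∑ n, (R * Yᵀ) m n ^ 2 := by
  rw [Finset.sum_comm]
  refine Finset.sum_congr rfl fun m _ => Finset.sum_congr rfl fun n _ => ?_
  rw [← Matrix.transpose_apply (Y * Rᵀ) m n, Matrix.transpose_mul, Matrix.transpose_transpose]

/-- `Σ (Yᵀ)_{mn}² = Σ Y_{mn}²`. -/
theorem sum_sq_transpose (Y : Matrix ι ι ℝ) : ∑ m, ∑ n, Yᵀ m n ^ 2 = ∑ m, ∑ n, Y m n ^ 2 := by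
  rw [Finset.sum_comm]; rfl

/-- **`‖R M Rᵀ‖_F² ≤ λ² ‖M‖_F²`** under the form bound `y ⬝ (RᵀR) y ≤ λ‖y‖²` (`λ ≥ 0`). -/
theorem sum_sq_conj_le (R M : Matrix ι ι ℝ) {lam : ℝ} (hlam0 : 0 ≤ lam)
    (hlam : ∀ y : ι → ℝ, y ⬝ᵥ ((Rᵀ * R) *ᵥ y) ≤ lam * (y ⬝ᵥ y)) :
    ∑ m, ∑ n, (R * M * Rᵀ) m n ^ 2 ≤ lam ^ 2 * ∑ i, ∑ j, M i j ^ 2 := by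
  rw [Matrix.mul_assoc]
  refine (sum_sq_mul_le R (M * Rᵀ) hlam).trans ?_
  rw [sum_sq_mul_transpose, pow_two, mul_assoc]
  refine mul_le_mul_of_nonneg_left ?_ hlam0
  refine (sum_sq_mul_le R Mᵀ hlam).trans (le_of_eq ?_)
  rw [sum_sq_transpose]

/-- `tr(X X) ≤ tr(X Xᵀ)`: `Σ X_{mn}X_{nm} ≤ Σ X_{mn}²` (AM–GM entrywise). -/
theorem sum_mul_swap_le_sum_sq (X : Matrix ι ι ℝ) : ∑ m, ∑ n, X m n * X n m ≤ ∑ m, ∑ n, X m n ^ 2 := by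
  have h : 0 ≤ ∑ m, ∑ n, (X m n - X n m) ^ 2 := Finset.sum_nonneg fun m _ => Finset.sum_nonneg fun n _ => sq_nonneg _
  have e : ∑ m, ∑ n, (X m n - X n m) ^ 2 = 2 * ∑ m, ∑ n, X m n ^ 2 - 2 * ∑ m, ∑ n, X m n * X n m := by
    have e1 : ∀ m n, (X m n - X n m) ^ 2 = X m n ^ 2 + X n m ^ 2 - 2 * (X m n * X n m) := fun m n => by ring
    simp only [e1, Finset.sum_sub_distrib, Finset.sum_add_distrib, ← Finset.mul_sum]
    have e2 : ∑ m, ∑ n, X n m ^ 2 = ∑ m, ∑ n, X m n ^ 2 := Finset.sum_comm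
    rw [e2]; ring
  linarith

/-- The first two-line trace in entries: `Σ_{ik} S_{ik} (M S Mᵀ)_{ik} = Σ_{mn} X_{mn}²` with `S = RᵀR`, `X = R M Rᵀ`. -/
theorem sum_S_mul_MSMt_eq (R M : Matrix ι ι ℝ) :
    ∑ i, ∑ k, (Rᵀ * R) i k * (M * (Rᵀ * R) * Mᵀ) i k = ∑ m, ∑ n, (R * M * Rᵀ) m n ^ 2 := by
  have h1 : ∑ i, ∑ k, (Rᵀ * R) i k * (M * (Rᵀ * R) * Mᵀ) i k = Matrix.trace ((Rᵀ * R)ᵀ * (M * (Rᵀ * R) * Mᵀ)) := by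
    simp only [Matrix.trace, Matrix.diag, Matrix.mul_apply, Matrix.transpose_apply]
    rw [Finset.sum_comm]
  have h2 : ∑ m, ∑ n, (R * M * Rᵀ) m n ^ 2 = Matrix.trace ((R * M * Rᵀ) * (R * M * Rᵀ)ᵀ) := by
    simp only [Matrix.trace, Matrix.diag, Matrix.mul_apply, Matrix.transpose_apply, pow_two]
  rw [h1, h2, Matrix.transpose_mul, Matrix.transpose_transpose]
  rw [Matrix.transpose_mul, Matrix.transpose_mul, Matrix.transpose_transpose]
  rw [Matrix.mul_assoc Rᵀ R, Matrix.trace_mul_comm Rᵀ]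
  congr 1
  simp only [Matrix.mul_assoc]

/-- The second two-line trace in entries: `Σ_{ik} (S Mᵀ)_{ik} (M S)_{ik} = Σ_{mn} X_{mn} X_{nm}`. -/
theorem sum_SMt_mul_MS_eq (R M : Matrix ι ι ℝ) :
    ∑ i, ∑ k, ((Rᵀ * R) * Mᵀ) i k * (M * (Rᵀ * R)) i k = ∑ m, ∑ n, (R * M * Rᵀ) m n * (R * M * Rᵀ) n m := by
  have h1 : ∑ i, ∑ k, ((Rᵀ * R) * Mᵀ) i k * (M * (Rᵀ * R)) i k = Matrix.trace (((Rᵀ * R) * Mᵀ)ᵀ * (M * (Rᵀ * R))) := by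
    simp only [Matrix.trace, Matrix.diag, Matrix.mul_apply, Matrix.transpose_apply]
    rw [Finset.sum_comm]
  have h2 : ∑ m, ∑ n, (R * M * Rᵀ) m n * (R * M * Rᵀ) n m = Matrix.trace ((R * M * Rᵀ) * (R * M * Rᵀ)) := by
    simp only [Matrix.trace, Matrix.diag, Matrix.mul_apply]
  rw [h1, h2, Matrix.transpose_mul, Matrix.transpose_mul, Matrix.transpose_transpose, Matrix.transpose_transpose]
  rw [show M * (Rᵀ * R) * (M * (Rᵀ * R)) = (M * Rᵀ * R * M * Rᵀ) * R by simp only [Matrix.mul_assoc],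
    Matrix.trace_mul_comm _ R]
  congr 1
  simp only [Matrix.mul_assoc]

/-- **THE TWO-LINE BOUND**: for `S = RᵀR` with `y ⬝ S y ≤ λ‖y‖²` (`λ ≥ 0`) and any `M`,
`Σ_{ik} [S_{ik}(M S Mᵀ)_{ik} + (S Mᵀ)_{ik}(M S)_{ik}] ≤ 2 λ² Σ M_{ij}²` (`= tr(S M S Mᵀ) + tr(M S M S) ≤ 2λ²‖M‖_F²`). -/
theorem twoLine_le (R M : Matrix ι ι ℝ) {lam : ℝ} (hlam0 : 0 ≤ lam)
    (hlam : ∀ y : ι → ℝ, y ⬝ᵥ ((Rᵀ * R) *ᵥ y) ≤ lam * (y ⬝ᵥ y)) :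
    ∑ i, ∑ k, ((Rᵀ * R) i k * (M * (Rᵀ * R) * Mᵀ) i k + ((Rᵀ * R) * Mᵀ) i k * (M * (Rᵀ * R)) i k) ≤
      2 * lam ^ 2 * ∑ i, ∑ j, M i j ^ 2 := by
  simp only [Finset.sum_add_distrib]
  rw [sum_S_mul_MSMt_eq, sum_SMt_mul_MS_eq]
  have h1 := sum_sq_conj_le R M hlam0 hlam
  have h2 := sum_mul_swap_le_sum_sq (R * M * Rᵀ)
  linarith

/-- **Inverse of a floor**: if `P` is positive definite with `μ‖y‖² ≤ y ⬝ P y` (`μ > 0`), then `x ⬝ P⁻¹ x ≤ μ⁻¹‖x‖²`. -/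
theorem inv_quadForm_le_of_floor [DecidableEq ι] (P : Matrix ι ι ℝ) (hP : P.PosDef) {μ : ℝ} (hμ : 0 < μ)
    (hfloor : ∀ y : ι → ℝ, μ * (y ⬝ᵥ y) ≤ y ⬝ᵥ (P *ᵥ y)) (x : ι → ℝ) :
    x ⬝ᵥ (P⁻¹ *ᵥ x) ≤ μ⁻¹ * (x ⬝ᵥ x) := by
  have hPu : IsUnit P.det := isUnit_iff_ne_zero.mpr hP.det_pos.ne'
  set y := P⁻¹ *ᵥ x with hy
  have hx : P *ᵥ y = x := by rw [hy, Matrix.mulVec_mulVec, Matrix.mul_nonsing_inv _ hPu, Matrix.one_mulVec]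
  have hq : x ⬝ᵥ y = y ⬝ᵥ (P *ᵥ y) := by rw [← hx, dotProduct_comm]
  set q := y ⬝ᵥ (P *ᵥ y) with hqdef
  have hqy : μ * (y ⬝ᵥ y) ≤ q := hfloor y
  have hyy : 0 ≤ y ⬝ᵥ y := Finset.sum_nonneg fun i _ => mul_self_nonneg _
  have hq0 : 0 ≤ q := (mul_nonneg hμ.le hyy).trans hqy
  have hCS : q ^ 2 ≤ (y ⬝ᵥ y) * (x ⬝ᵥ x) := by
    have h := Finset.sum_mul_sq_le_sq_mul_sq Finset.univ y x
    have e1 : ∑ i, y i * x i = q := by rw [hq.symm.trans (dotProduct_comm x y)]; rfl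
    simp only [pow_two] at h ⊢; simp only [dotProduct]; rw [← e1]; simpa only [pow_two] using h
  rw [hq]
  have hxx : 0 ≤ x ⬝ᵥ x := Finset.sum_nonneg fun i _ => mul_self_nonneg _
  have h1 : μ * q ^ 2 ≤ q * (x ⬝ᵥ x) :=
    calc μ * q ^ 2 ≤ μ * ((y ⬝ᵥ y) * (x ⬝ᵥ x)) := mul_le_mul_of_nonneg_left hCS hμ.le
      _ = (μ * (y ⬝ᵥ y)) * (x ⬝ᵥ x) := by ring
      _ ≤ q * (x ⬝ᵥ x) := mul_le_mul_of_nonneg_right hqy hxx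
  rcases hq0.lt_or_eq with hqpos | hq0'
  · have h2 : μ * q ≤ x ⬝ᵥ x :=
      le_of_mul_le_mul_right (by calc (μ * q) * q = μ * q ^ 2 := by ring
        _ ≤ q * (x ⬝ᵥ x) := h1
        _ = (x ⬝ᵥ x) * q := by ring) hqpos
    calc q = μ⁻¹ * (μ * q) := by rw [← mul_assoc, inv_mul_cancel₀ hμ.ne', one_mul]
      _ ≤ μ⁻¹ * (x ⬝ᵥ x) := mul_le_mul_of_nonneg_left h2 (inv_nonneg.mpr hμ.le)
  · rw [← hq0']
    exact mul_nonneg (inv_nonneg.mpr hμ.le) hxx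

end MatrixAlgebra

/-! ## §2 Gaussian moments of a quadratic form under `exp(−β vᵀPv) dv` (Wick, ✓`GaussianChartWickFintype`) -/

section Gaussian

variable {ι : Type*} [Fintype ι] [DecidableEq ι]

omit [DecidableEq ι] in
/-- Two legs against the Gaussian weight are integrable. -/
theorem integrable_two_legs (P : Matrix ι ι ℝ) (hP : P.PosDef) {β : ℝ} (hβ : 0 < β) (a b : ι → ℝ) :
    Integrable (fun v : ι → ℝ => (a ⬝ᵥ v) * (b ⬝ᵥ v) * Real.exp (-(β * (v ⬝ᵥ P *ᵥ v)))) := by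
  have h := integrable_prod_dotProduct_mul_exp_quadForm' P hP hβ (Finset.univ : Finset (Fin 2)) ![a, b]
  refine h.congr (Filter.Eventually.of_forall fun v => ?_)
  simp [Fin.prod_univ_two]

omit [DecidableEq ι] in
/-- Four legs against the Gaussian weight are integrable. -/
theorem integrable_four_legs (P : Matrix ι ι ℝ) (hP : P.PosDef) {β : ℝ} (hβ : 0 < β) (a b c d : ι → ℝ) :
    Integrable (fun v : ι → ℝ => (a ⬝ᵥ v) * (b ⬝ᵥ v) * (c ⬝ᵥ v) * (d ⬝ᵥ v) * Real.exp (-(β * (v ⬝ᵥ P *ᵥ v)))) := by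
  have h := integrable_prod_dotProduct_mul_exp_quadForm' P hP hβ (Finset.univ : Finset (Fin 4)) ![a, b, c, d]
  refine h.congr (Filter.Eventually.of_forall fun v => ?_)
  simp [Fin.prod_univ_four, mul_assoc]

/-- A quadratic form is a sum of products of two legs: `v ⬝ M v = Σ_i (e_i ⬝ v)(M_i ⬝ v)` (`e_i = Pi.single i 1`, `M_i` the `i`-th row). -/
theorem quadForm_eq_sum_two_legs (M : Matrix ι ι ℝ) (v : ι → ℝ) :
    v ⬝ᵥ (M *ᵥ v) = ∑ i, (Pi.single i (1 : ℝ) ⬝ᵥ v) * (M i ⬝ᵥ v) := by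
  simp only [single_one_dotProduct]
  rfl

/-- **First Gaussian moment of a quadratic form**: `∫ (v ⬝ M v) e^{−β vᵀPv} dv = Z · Σ_i (2β)⁻¹ (e_i ⬝ P⁻¹ M_i)` (`= Z·(2β)⁻¹·tr(M P⁻¹)`). -/
theorem integral_quadForm_mul_exp (P : Matrix ι ι ℝ) (hP : P.PosDef) {β : ℝ} (hβ : 0 < β) (M : Matrix ι ι ℝ) :
    ∫ v : ι → ℝ, (v ⬝ᵥ (M *ᵥ v)) * Real.exp (-(β * (v ⬝ᵥ P *ᵥ v))) =
      Real.sqrt (Real.pi / β) ^ Fintype.card ι / Real.sqrt P.det *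
        ∑ i, (2 * β)⁻¹ * (Pi.single i (1 : ℝ) ⬝ᵥ (P⁻¹ *ᵥ M i)) := by
  have e1 : ∫ v : ι → ℝ, (v ⬝ᵥ (M *ᵥ v)) * Real.exp (-(β * (v ⬝ᵥ P *ᵥ v))) =
      ∫ v : ι → ℝ, ∑ i, (Pi.single i (1 : ℝ) ⬝ᵥ v) * (M i ⬝ᵥ v) * Real.exp (-(β * (v ⬝ᵥ P *ᵥ v))) :=
    integral_congr_ae (Filter.Eventually.of_forall fun v => by beta_reduce; rw [quadForm_eq_sum_two_legs M v, Finset.sum_mul])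
  rw [e1, integral_finsetSum _ (fun i _ => integrable_two_legs P hP hβ _ _)]
  simp_rw [integral_dotProduct_mul_dotProduct_mul_exp_quadForm' P hP hβ]
  rw [← Finset.mul_sum]

/-- **Second Gaussian moment of a quadratic form** (Wick's three pairings of the four legs `e_i, M_i, e_k, M_k`). -/
theorem integral_quadForm_sq_mul_exp (P : Matrix ι ι ℝ) (hP : P.PosDef) {β : ℝ} (hβ : 0 < β) (M : Matrix ι ι ℝ) :
    ∫ v : ι → ℝ, (v ⬝ᵥ (M *ᵥ v)) ^ 2 * Real.exp (-(β * (v ⬝ᵥ P *ᵥ v))) =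
      Real.sqrt (Real.pi / β) ^ Fintype.card ι / Real.sqrt P.det *
        ∑ i, ∑ k,
          (((2 * β)⁻¹ * (Pi.single i (1 : ℝ) ⬝ᵥ (P⁻¹ *ᵥ M i))) * ((2 * β)⁻¹ * (Pi.single k (1 : ℝ) ⬝ᵥ (P⁻¹ *ᵥ M k))) +
           ((2 * β)⁻¹ * (Pi.single i (1 : ℝ) ⬝ᵥ (P⁻¹ *ᵥ Pi.single k (1 : ℝ)))) * ((2 * β)⁻¹ * (M i ⬝ᵥ (P⁻¹ *ᵥ M k))) +
           ((2 * β)⁻¹ * (Pi.single i (1 : ℝ) ⬝ᵥ (P⁻¹ *ᵥ M k))) * ((2 * β)⁻¹ * (M i ⬝ᵥ (P⁻¹ *ᵥ Pi.single k (1 : ℝ))))) := by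
  have hsq : ∀ v : ι → ℝ, (v ⬝ᵥ (M *ᵥ v)) ^ 2 * Real.exp (-(β * (v ⬝ᵥ P *ᵥ v))) =
      ∑ i, ∑ k, (Pi.single i (1 : ℝ) ⬝ᵥ v) * (M i ⬝ᵥ v) * (Pi.single k (1 : ℝ) ⬝ᵥ v) * (M k ⬝ᵥ v) *
        Real.exp (-(β * (v ⬝ᵥ P *ᵥ v))) := by
    intro v
    rw [pow_two, quadForm_eq_sum_two_legs, Finset.sum_mul_sum, Finset.sum_mul]
    refine Finset.sum_congr rfl fun i _ => ?_
    rw [Finset.sum_mul]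
    refine Finset.sum_congr rfl fun k _ => ?_
    ring
  rw [integral_congr_ae (Filter.Eventually.of_forall hsq),
    integral_finsetSum _ (fun i _ => integrable_finsetSum _ fun k _ => integrable_four_legs P hP hβ _ _ _ _)]
  simp_rw [integral_finsetSum _ (fun k _ => integrable_four_legs P hP hβ _ _ _ _),
    integral_four_dotProduct_mul_exp_quadForm' P hP hβ]
  simp_rw [← Finset.mul_sum]

/-! ### The entries behind the legs -/

/-- `e_i ⬝ S e_k = S_{ik}`. -/
theorem single_S_single (S : Matrix ι ι ℝ) (i k : ι) :
    Pi.single i (1 : ℝ) ⬝ᵥ (S *ᵥ Pi.single k (1 : ℝ)) = S i k := by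
  rw [single_one_dotProduct, Matrix.mulVec_single_one]; rfl

/-- `e_i ⬝ S M_k = (S Mᵀ)_{ik}`. -/
theorem single_S_row (S M : Matrix ι ι ℝ) (i k : ι) :
    Pi.single i (1 : ℝ) ⬝ᵥ (S *ᵥ M k) = (S * Mᵀ) i k := by
  rw [single_one_dotProduct]
  simp only [Matrix.mulVec, dotProduct, Matrix.mul_apply, Matrix.transpose_apply]

/-- `M_i ⬝ S e_k = (M S)_{ik}`. -/
theorem row_S_single (S M : Matrix ι ι ℝ) (i k : ι) :
    M i ⬝ᵥ (S *ᵥ Pi.single k (1 : ℝ)) = (M * S) i k := by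
  rw [Matrix.mulVec_single_one]
  simp only [dotProduct, Matrix.mul_apply]
  rfl

omit [DecidableEq ι] in
/-- `M_i ⬝ S M_k = (M S Mᵀ)_{ik}`. -/
theorem row_S_row (S M : Matrix ι ι ℝ) (i k : ι) :
    M i ⬝ᵥ (S *ᵥ M k) = (M * S * Mᵀ) i k := by
  rw [Matrix.mul_assoc]
  simp only [Matrix.mulVec, dotProduct, Matrix.mul_apply, Matrix.transpose_apply]

/-! ### The variance bound -/

/-- **VARIANCE OF A QUADRATIC FORM UNDER THE CHART GAUSSIAN** (abstract 12b): for `P` positive definite with a floor `μ‖y‖² ≤ y ⬝ P y`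
(`μ > 0`), `β > 0` and any `M`, with `E₀[F] = Z⁻¹ ∫ F e^{−β vᵀPv} dv`:
`E₀[(v ⬝ M v)²] − E₀[v ⬝ M v]² ≤ (2β²μ²)⁻¹ · Σ_{ij} M_{ij}²`
(`Var = tr(S M S Mᵀ) + tr(M S M S) ≤ 2‖S‖²_op‖M‖²_F`, `S = (2β)⁻¹P⁻¹`, `‖S‖_op ≤ (2βμ)⁻¹`). -/
theorem variance_quadForm_le (P : Matrix ι ι ℝ) (hP : P.PosDef) {β : ℝ} (hβ : 0 < β) {μ : ℝ} (hμ : 0 < μ)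
    (hfloor : ∀ y : ι → ℝ, μ * (y ⬝ᵥ y) ≤ y ⬝ᵥ (P *ᵥ y)) (M : Matrix ι ι ℝ) :
    (∫ v : ι → ℝ, (v ⬝ᵥ (M *ᵥ v)) ^ 2 * Real.exp (-(β * (v ⬝ᵥ P *ᵥ v)))) /
          (Real.sqrt (Real.pi / β) ^ Fintype.card ι / Real.sqrt P.det) -
        ((∫ v : ι → ℝ, (v ⬝ᵥ (M *ᵥ v)) * Real.exp (-(β * (v ⬝ᵥ P *ᵥ v)))) /
          (Real.sqrt (Real.pi / β) ^ Fintype.card ι / Real.sqrt P.det)) ^ 2 ≤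
      (2 * β ^ 2 * μ ^ 2)⁻¹ * ∑ i, ∑ j, M i j ^ 2 := by
  set Z : ℝ := Real.sqrt (Real.pi / β) ^ Fintype.card ι / Real.sqrt P.det with hZ
  have hZpos : 0 < Z := div_pos (pow_pos (Real.sqrt_pos.mpr (div_pos Real.pi_pos hβ)) _) (Real.sqrt_pos.mpr hP.det_pos)
  rw [integral_quadForm_sq_mul_exp P hP hβ M, integral_quadForm_mul_exp P hP hβ M]
  rw [mul_div_cancel_left₀ _ hZpos.ne', mul_div_cancel_left₀ _ hZpos.ne']
  simp only [single_S_single, single_S_row, row_S_single, row_S_row]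
  set c : ℝ := (2 * β)⁻¹ with hc
  rw [show (∑ i, c * (P⁻¹ * Mᵀ) i i) ^ 2 = ∑ i, ∑ k, (c * (P⁻¹ * Mᵀ) i i) * (c * (P⁻¹ * Mᵀ) k k) by
    rw [pow_two, Finset.sum_mul_sum]]
  have hsplit : ∑ i, ∑ k, (c * (P⁻¹ * Mᵀ) i i * (c * (P⁻¹ * Mᵀ) k k) +
        c * P⁻¹ i k * (c * (M * P⁻¹ * Mᵀ) i k) + c * (P⁻¹ * Mᵀ) i k * (c * (M * P⁻¹) i k)) -
      ∑ i, ∑ k, c * (P⁻¹ * Mᵀ) i i * (c * (P⁻¹ * Mᵀ) k k) =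
      c ^ 2 * ∑ i, ∑ k, (P⁻¹ i k * (M * P⁻¹ * Mᵀ) i k + (P⁻¹ * Mᵀ) i k * (M * P⁻¹) i k) := by
    rw [← Finset.sum_sub_distrib, Finset.mul_sum]
    refine Finset.sum_congr rfl fun i _ => ?_
    rw [← Finset.sum_sub_distrib, Finset.mul_sum]
    refine Finset.sum_congr rfl fun k _ => ?_
    ring
  rw [hsplit]
  obtain ⟨R, hR⟩ := exists_transpose_mul_self P⁻¹ hP.inv
  have hlam : ∀ y : ι → ℝ, y ⬝ᵥ ((Rᵀ * R) *ᵥ y) ≤ μ⁻¹ * (y ⬝ᵥ y) := by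
    intro y; rw [hR]; exact inv_quadForm_le_of_floor P hP hμ hfloor y
  have h2 := twoLine_le R M (inv_nonneg.mpr hμ.le) hlam
  rw [hR] at h2
  have hc0 : 0 ≤ c ^ 2 := sq_nonneg _
  calc c ^ 2 * ∑ i, ∑ k, (P⁻¹ i k * (M * P⁻¹ * Mᵀ) i k + (P⁻¹ * Mᵀ) i k * (M * P⁻¹) i k)
      ≤ c ^ 2 * (2 * μ⁻¹ ^ 2 * ∑ i, ∑ j, M i j ^ 2) := mul_le_mul_of_nonneg_left h2 hc0
    _ = (2 * β ^ 2 * μ ^ 2)⁻¹ * ∑ i, ∑ j, M i j ^ 2 := by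
        rw [hc]; field_simp

end Gaussian

/-! ## §3 The task letters: `gaussCov β H (quadVal M) (quadVal M)` in the edge chart (flat transfer ✓`EdgeChartGaussian`) -/

section Task

open LaplaceSandwich (flatten flatten_apply)

/-- The planner's flattening `flat a` IS fcl-p3's measurable flattening `flatten`. -/
theorem flat_eq_flatten {H : ℕ} (a : LandauFree H → E3) : flat a = flatten (LandauFree H) a := by
  funext i; rfl

/-- The Hodge form of the chart in the flat variable: `boxQuadForm H a = ♭a ⬝ (hodgeQ H ⊗ 1₃) ♭a`. -/
theorem boxQuadForm_eq_flat (H : ℕ) (a : LandauFree H → E3) :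
    boxQuadForm H a = flatten (LandauFree H) a ⬝ᵥ ((hodgeQ H ⊗ₖ (1 : Matrix (Fin 3) (Fin 3) ℝ)) *ᵥ flatten (LandauFree H) a) :=
  EdgeChartGaussian.colourForm_eq_flat (hodgeQ H) a

/-- The quadratic form of the task in the flat variable. -/
theorem quadVal_eq_flat {H : ℕ} (M : Matrix (LandauFree H × Fin 3) (LandauFree H × Fin 3) ℝ) (a : LandauFree H → E3) :
    quadVal M a = flatten (LandauFree H) a ⬝ᵥ (M *ᵥ flatten (LandauFree H) a) := by
  rw [quadVal, flat_eq_flatten]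

/-- **Transfer of the moments**: `∫ (quadVal M a)^k · e^{−β·boxQuadForm H a} da = ∫ (v ⬝ M v)^k · e^{−β vᵀ(hodgeQ ⊗ 1)v} dv`. -/
theorem integral_quadVal_pow_mul_gaussWeight (β : ℝ) (H : ℕ) (M : Matrix (LandauFree H × Fin 3) (LandauFree H × Fin 3) ℝ) (k : ℕ) :
    ∫ a : LandauFree H → E3, quadVal M a ^ k * gaussWeight β H a =
      ∫ v : LandauFree H × Fin 3 → ℝ, (v ⬝ᵥ (M *ᵥ v)) ^ k *
        Real.exp (-(β * (v ⬝ᵥ ((hodgeQ H ⊗ₖ (1 : Matrix (Fin 3) (Fin 3) ℝ)) *ᵥ v)))) := by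
  rw [← EdgeChartGaussian.integral_eq_flat]
  refine integral_congr_ae (Filter.Eventually.of_forall fun a => ?_)
  simp only [quadVal_eq_flat, gaussWeight, boxQuadForm_eq_flat]

/-- The normaliser in the flat variable: `∫ e^{−β·boxQuadForm} da = √(π/β)^{3|E|}/√det(hodgeQ ⊗ 1)`. -/
theorem integral_gaussWeight (H : ℕ) {β : ℝ} (hβ : 0 < β) :
    ∫ a : LandauFree H → E3, gaussWeight β H a =
      Real.sqrt (Real.pi / β) ^ Fintype.card (LandauFree H × Fin 3) /
        Real.sqrt (hodgeQ H ⊗ₖ (1 : Matrix (Fin 3) (Fin 3) ℝ)).det := by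
  have h := integral_quadVal_pow_mul_gaussWeight β H 0 0
  simp only [pow_zero, one_mul] at h
  rw [h, integral_exp_neg_quadForm' _ (GaussianChartWick.posDef_kronecker_one _ (hodgeQ_posDef H)) hβ]

/-- **The floor of the colour-diagonal precision** from ✓S1: `c/H²·‖x‖² ≤ x ⬝ (hodgeQ H ⊗ 1₃) x`. -/
theorem kronecker_hodgeQ_floor (H : ℕ) {c : ℝ} (hc : ∀ v : LandauFree H → ℝ, c / (H : ℝ) ^ 2 * (v ⬝ᵥ v) ≤ v ⬝ᵥ (hodgeQ H *ᵥ v))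
    (x : LandauFree H × Fin 3 → ℝ) :
    c / (H : ℝ) ^ 2 * (x ⬝ᵥ x) ≤ x ⬝ᵥ ((hodgeQ H ⊗ₖ (1 : Matrix (Fin 3) (Fin 3) ℝ)) *ᵥ x) := by
  rw [Matrix.kronecker_one]
  exact SpectralFloor.floor_blockDiagonal_const (hodgeQ H) hc x

end Task

end QuadFluct

open QuadFluct in
/-- **T-S5.12b `QuadFormFluct`** — Gaussian variance of a quadratic form of the edge field: `Var₀(a·Ma) ≤ C·(H⁴/β²)·Σ M_{ij}²` with
`C = 1/(2c₁²)`, `c₁` the Hodge–Poincaré constant of ✓S1 `stub_hodgePoincare` (`Var = tr(SMSMᵀ) + tr(MSMS) ≤ 2‖S‖²_op‖M‖²_F`,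
`S = (2β)⁻¹(hodgeQ⁻¹ ⊗ 1₃)`, `‖S‖_op ≤ (2β)⁻¹H²/c₁`). -/
theorem quadFormFluct : QuadFormFluct := by
  obtain ⟨c, hc, hS1⟩ := stub_hodgePoincare
  refine ⟨(2 * c ^ 2)⁻¹, fun H hH β hβ M => ?_⟩
  set P : Matrix (LandauFree H × Fin 3) (LandauFree H × Fin 3) ℝ := hodgeQ H ⊗ₖ (1 : Matrix (Fin 3) (Fin 3) ℝ) with hPdef
  have hP : P.PosDef := GaussianChartWick.posDef_kronecker_one _ (hodgeQ_posDef H)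
  have hH0 : (0 : ℝ) < H := by exact_mod_cast hH
  have hμ : 0 < c / (H : ℝ) ^ 2 := by positivity
  have hfloor : ∀ y : LandauFree H × Fin 3 → ℝ, c / (H : ℝ) ^ 2 * (y ⬝ᵥ y) ≤ y ⬝ᵥ (P *ᵥ y) :=
    kronecker_hodgeQ_floor H (hS1 H hH)
  have key := variance_quadForm_le P hP hβ hμ hfloor M
  have h2 : ∫ a : LandauFree H → E3, (fun a => quadVal M a * quadVal M a) a * gaussWeight β H a =
      ∫ v : LandauFree H × Fin 3 → ℝ, (v ⬝ᵥ (M *ᵥ v)) ^ 2 * Real.exp (-(β * (v ⬝ᵥ (P *ᵥ v)))) := by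
    rw [← integral_quadVal_pow_mul_gaussWeight β H M 2]
    refine integral_congr_ae (Filter.Eventually.of_forall fun a => ?_)
    simp only [pow_two]
  have h1 : ∫ a : LandauFree H → E3, quadVal M a * gaussWeight β H a =
      ∫ v : LandauFree H × Fin 3 → ℝ, (v ⬝ᵥ (M *ᵥ v)) * Real.exp (-(β * (v ⬝ᵥ (P *ᵥ v)))) := by
    have h1' := integral_quadVal_pow_mul_gaussWeight β H M 1
    simp only [pow_one] at h1'
    exact h1'
  have h0 := integral_gaussWeight H hβ
  unfold gaussCov gaussAvg
  rw [h2, h1, h0, ← pow_two]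
  refine key.trans (le_of_eq ?_)
  field_simp

end Summit.QuantumFields.YangMills.Theorems.AllWindowsColdBoxBoxHighLine

end
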